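import Summits.SmoothPoincare4.SmoothPoincare4.Theorems.CylinderEntropyCylinderRungTwoLiminfDensity
import Summits.SmoothPoincare4.SmoothPoincare4.Theorems.CylinderEntropyCylinderRungTwoContinuousAtCylDensity
import Summits.SmoothPoincare4.SmoothPoincare4.Theorems.CylinderEntropyCylinderRungTwoHamiltonMonotonicity
import Summits.SmoothPoincare4.SmoothPoincare4.Theorems.CylinderEntropyCylinderRungTwoKillingFluxDefs
import HarnessLib

/-!
# Route `CylinderEntropy`, crux `CylinderRungTwo` (stmt-SmoothPoincare4-7631), line `killing-flux`:
# UNIT LOWER DENSITY ALONG A SMOOTH CYLINDER FLOW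

Registered helper `helper_unitLowerDensityAlongFlow` (lead c3, step H4).  For a smooth mean curvature
flow `IsCylinderMCF M F ν T` of closed embedded cross-sections of `N = S⁴ × ℝ ⊂ ℝ⁶`, every `s ≥ T`,
every lag `σ > 0` and every `x ∈ M`:

  `1 ≤ F̂_{F_{s+σ}(x), σ}(F_s(M))`,

the typed slice-normalised Gaussian density of the EARLIER time slice `F_s(M)`, at scale `σ`, centred
at any point REACHED by the flow `σ` later, is at least one.  This is the cylinder version of the unit
lower density bound behind Brakke's clearing-out lemma and every no-mass-drop / lower-density argument
for smooth flows (Euclidean model: Huisken's monotonicity with the fact that the Gaussian density of a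
smooth point is `1`).

Proof (three landed inputs).  Hamilton's monotonicity in `N` (`stub_hamiltonMonotonicity`, landed):
`F̂_{p,τ}(F_{s+σ}(M)) ≤ F̂_{p,τ+σ}(F_s(M))` for all `τ > 0`; as `τ → 0⁺` the left side is eventually
`≥ 1 - η` for every `η > 0` (`helper_liminfCylDensityAtPoint`: Colding–Minicozzi 7.2 (3) + Cheeger–Yau
kernel domination), and the right side tends to `F̂_{p,σ}(F_s(M))` (`helper_continuousAt_cylDensity`:
dominated convergence in the scale).  Everything is PROVED (no `sorry`, no definitions, no named facts).

References: R. S. Hamilton, Comm. Anal. Geom. 1 (1993) 127–137, Thm. 4.1; K. Brakke, *The motion of a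
surface by its mean curvature* (1978), §6.3 (clearing out); T. H. Colding, W. P. Minicozzi II, Ann. of
Math. 175 (2012), Lemma 7.2.
-/

noncomputable section

-- the prescribed namespace `Summit.SmoothPoincare4.SmoothPoincare4.…` repeats `SmoothPoincare4`
set_option linter.dupNamespace false

open MeasureTheory Set Filter
open scoped Manifold ContDiff ENNReal NNReal Topology BigOperators

namespace Summit.SmoothPoincare4.SmoothPoincare4.Cruxes.CylinderRungTwo.KillingFlux

open Literature.Geometry.Riemannian
open Literature.Geometry.Riemannian.SphericalCylinderEntropy (cylEntropy cylDensity cylKernel truncL)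

/-- `τ ↦ τ + σ` maps the right-neighbourhood filter of `0` into the neighbourhood filter of `σ`.
[folklore] -/
theorem tendsto_add_const_nhdsGT_zero (σ : ℝ) :
    Tendsto (fun τ : ℝ => τ + σ) (𝓝[>] (0 : ℝ)) (𝓝 σ) := by
  have h : Tendsto (fun τ : ℝ => τ + σ) (𝓝 (0 : ℝ)) (𝓝 (0 + σ)) :=
    (continuous_id.add continuous_const).tendsto 0
  rw [zero_add] at h
  exact h.mono_left nhdsWithin_le_nhds

/-- `ENNReal.ofReal (1 - η) → 1` as `η → 0⁺`. [folklore] -/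
theorem tendsto_ofReal_one_sub_nhdsGT_zero :
    Tendsto (fun η : ℝ => ENNReal.ofReal (1 - η)) (𝓝[>] (0 : ℝ)) (𝓝 1) := by
  have hc : Continuous fun η : ℝ => 1 - η := continuous_const.sub continuous_id
  have h := ENNReal.tendsto_ofReal (hc.tendsto 0)
  rw [sub_zero, ENNReal.ofReal_one] at h
  exact h.mono_left nhdsWithin_le_nhds

/-- **Unit lower density from the three inputs** (monotonicity, `liminf ≥ 1` at the later slice,
continuity in the scale at the earlier slice), for one flow, one pair of times and one point: the
bookkeeping of limits. [cite: Hamilton1993, Thm. 4.1] -/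
theorem one_le_cylDensity_of_inputs {A B : Set (EuclideanSpace ℝ (Fin 6))}
    {p : EuclideanSpace ℝ (Fin 6)} {σ : ℝ}
    (hmono : ∀ τ : ℝ, 0 < τ → cylDensity B p τ ≤ cylDensity A p (τ + σ))
    (hlim : ∀ η : ℝ, 0 < η → ∀ᶠ τ in 𝓝[>] (0 : ℝ), ENNReal.ofReal (1 - η) ≤ cylDensity B p τ)
    (hcont : ContinuousAt (fun τ : ℝ => cylDensity A p τ) σ) :
    1 ≤ cylDensity A p σ := by
  -- the right side tends to `F̂_{p,σ}(A)` as `τ → 0⁺`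
  have hT : Tendsto (fun τ : ℝ => cylDensity A p (τ + σ)) (𝓝[>] (0 : ℝ)) (𝓝 (cylDensity A p σ)) :=
    hcont.tendsto.comp (tendsto_add_const_nhdsGT_zero σ)
  -- for every `η > 0`: `1 - η ≤ F̂_{p,σ}(A)`
  have hη : ∀ η : ℝ, 0 < η → ENNReal.ofReal (1 - η) ≤ cylDensity A p σ := by
    intro η hη
    refine ge_of_tendsto hT ?_
    filter_upwards [hlim η hη, self_mem_nhdsWithin] with τ h1 hτ
    exact h1.trans (hmono τ hτ)
  -- let `η → 0⁺`
  refine le_of_tendsto tendsto_ofReal_one_sub_nhdsGT_zero ?_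
  filter_upwards [self_mem_nhdsWithin] with η hη0
  exact hη η hη0

/-- **Registered helper `helper_unitLowerDensityAlongFlow` (H4): UNIT LOWER DENSITY ALONG A SMOOTH
CYLINDER FLOW.**  For `IsCylinderMCF M F ν T`, `T ≤ s`, `0 < σ` and `x ∈ M`:
`1 ≤ F̂_{F (s+σ) x, σ}(F_s(M))` — Hamilton's monotonicity (`stub_hamiltonMonotonicity`), the `liminf ≥ 1`
of the typed density at a point of the later slice (`helper_liminfCylDensityAtPoint`) and continuity of the
density of the earlier slice in the scale (`helper_continuousAt_cylDensity`). [cite: Hamilton1993, Thm. 4.1] -/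
theorem helper_unitLowerDensityAlongFlow : ∀ (M : Type) [TopologicalSpace M] [T2Space M] [SecondCountableTopology M] [ChartedSpace (EuclideanSpace ℝ (Fin 4)) M] [IsManifold (𝓡 4) ∞ M] [CompactSpace M] (F : ℝ → M → EuclideanSpace ℝ (Fin 6)) (ν : ℝ → M → EuclideanSpace ℝ (Fin 6)) (T : ℝ), IsCylinderMCF M F ν T → ∀ s σ : ℝ, T ≤ s → 0 < σ → ∀ x : M, 1 ≤ cylDensity (Set.range (F s)) (F (s + σ) x) σ := by
  intro M _ _ _ _ _ _ F ν T hF s σ hs hσ x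
  have hsσ : T ≤ s + σ := by linarith
  have hp : ∑ i : Fin 5, F (s + σ) x (Fin.castSucc i) ^ 2 = 1 := hF.mem_cyl (s + σ) hsσ x
  -- the earlier slice: compact, in `N`, of finite area
  have hAc : IsCompact (Set.range (F s)) :=
    isCompact_range (hF.isSmoothEmbedding s hs).contMDiff.continuous
  have hAN : ∀ z ∈ Set.range (F s), ∑ i : Fin 5, z (Fin.castSucc i) ^ 2 = 1 := by
    rintro _ ⟨y, rfl⟩; exact hF.mem_cyl s hs y
  have hAfin : μH[4] (Set.range (F s)) < ⊤ :=
    hausdorffMeasure_range_lt_top_six M (hF.isSmoothEmbedding s hs)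
  refine one_le_cylDensity_of_inputs (B := Set.range (F (s + σ))) ?_ ?_ ?_
  · intro τ hτ
    exact stub_hamiltonMonotonicity M F ν T hF (F (s + σ) x) hp s σ τ hs hσ.le hτ
  · intro η hη
    exact helper_liminfCylDensityAtPoint M (F (s + σ)) (hF.isSmoothEmbedding (s + σ) hsσ)
      (hF.mem_cyl (s + σ) hsσ) x η hη
  · exact helper_continuousAt_cylDensity (Set.range (F s)) hAc hAN hAfin (F (s + σ) x) σ hσ

end Summit.SmoothPoincare4.SmoothPoincare4.Cruxes.CylinderRungTwo.KillingFlux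

end
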